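import Literature.Probability.RandomPlanarGeometry.LoewnerArcConfinement
import Literature.Probability.RandomPlanarGeometry.SLETraceHittingMarkov
import Literature.Probability.RandomPlanarGeometry.SLESwallowingTimeZero
import Literature.Probability.RandomPlanarGeometry.SLEBoundaryHittingProofs
import Literature.Probability.RandomPlanarGeometry.LoewnerTipPreimage
import Literature.Probability.RandomPlanarGeometry.RohdeSchrammCor35Proofs
import Mathlib.MeasureTheory.Constructions.BorelSpace.WithTop
import HarnessLib

/-!
# Arc confinement: the SLE_κ trace, `4 < κ < 8`, has no sub-path confined to a simple arc

Topic `Probability/RandomPlanarGeometry`; theorems only (regularity input of the refutation of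
crux `stmt-CriticalPhenomena-0698`: the chordal SLE₆ curve traces no straight segment and no
circle arc, in any Dobrushin domain).

**Theorem** (`ae_not_injOn_sleTrace`). For `4 < κ < 8`, almost surely: for all `t₁ < t₂` and
every continuous `ρ : ℂ → ℝ`, `ρ` is NOT injective on `γ[t₁, t₂]` (`γ = sleTrace κ ω`).
Equivalently no piece `γ[t₁, t₂]` is a point or a simple arc carrying a continuous real
parameter; in particular no piece lies on a line (`ρ` a linear form) or on a circle arc smaller
than a half circle (`ρ` the projection to the chord).

Proof (`not_injOn_of_touch` + the a.s. inputs). Pathwise, suppose `ρ` is injective on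
`γ[t₁, t₂]`. By strict hull growth some `γ t'`, `t' ∈ (t₁, t₂)`, is off `γ[0, t₁] ∪ ℝ`, hence
inside a rational closed ball `B` disjoint from `γ[0, t₁] ∪ ℝ`; the first hitting time `r` of `B`
lies in `(t₁, t₂)`, `γ r ∈ ℍ` and `γ r ∉ γ[0, r)`. INPUT (a.s., for all rational balls at once):
right after `r` the curve touches `ℝ ∪ γ[0, r]` at points `≠ γ r` — by the strong Markov property
at `r` (`ae_sleTrace_add_eq_extendFrom_hitting`: `γ(r + u) = f̄_r(γ^r(u) + W r)` with `γ^r` the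
trace of the driver after `r`) and boundary touching of the fresh chain (the swallowing times
`T_{1/(k+1)}` of the after-driver tend to `0`, `κ > 4`; at such a time `γ^r` is on `realRay`,
so `γ(r + T)` is `f̄_r` of a real point `≠ W r`: on `∂H_r ⊆ ℝ ∪ γ[0, r]`
(`IsGeneratedByCurve.bdryInv_ofReal_mem`) and `≠ γ r`
(`IsGeneratedByCurve.eq_driving_of_bdryInv_eq_of_notMem`)). These points tend to `γ r ∈ ℍ`, so
they are points of `γ[0, r]`, and the deterministic core
(`IsGeneratedByCurve.mem_image_Icc_of_injOn`, `LoewnerArcConfinement`) gives `γ r ∈ γ[0, t₁]`,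
contradicting the first hitting of `B` at `r > t₁`.

References: S. Rohde, O. Schramm, *Basic properties of SLE*, Ann. of Math. 161 (2005), §6–7;
G. F. Lawler, *Conformally Invariant Processes in the Plane* (2005), §4.1, §6.2, Prop. 6.8.
-/

noncomputable section

open Set Filter Topology MeasureTheory

open scoped NNReal

namespace Literature.Probability.RandomPlanarGeometry

namespace Loewner

variable {W : ℝ≥0 → ℝ} {γ : ℝ≥0 → ℂ}

/-! ### Deterministic complements -/

/-- **No stalling modulo the real line**: for `a < b` the piece `γ[a, b]` is not contained in
`γ[0, a] ∪ ℝ` (real points do not change `ℍ ∖ γ[0, ·]`). [folklore] -/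
theorem IsGeneratedByCurve.not_image_Icc_subset_union_real (hW : Continuous W)
    (h : IsGeneratedByCurve W γ) {a b : ℝ≥0} (hab : a < b) :
    ¬ γ '' Icc a b ⊆ γ '' Icc 0 a ∪ {z : ℂ | z.im = 0} := by
  intro hsub
  refine (hull_ssubset_hull hW hab).ne ?_
  have hdiff : UpperHalfPlane.upperHalfPlaneSet \ γ '' Icc 0 b =
      UpperHalfPlane.upperHalfPlaneSet \ γ '' Icc 0 a := by
    ext z
    simp only [Set.mem_sdiff]
    constructor
    · rintro ⟨hz, hnot⟩
      exact ⟨hz, fun hm ↦ hnot (image_mono (Icc_subset_Icc_right hab.le) hm)⟩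
    · rintro ⟨hz, hnot⟩
      refine ⟨hz, fun hm ↦ ?_⟩
      rw [← Icc_union_Icc_eq_Icc (zero_le (a := a)) hab.le, image_union] at hm
      rcases hm with hm | hm
      · exact hnot hm
      · rcases hsub hm with hm' | hm'
        · exact hnot hm'
        · exact absurd (show (0 : ℝ) < z.im from hz) (by rw [show z.im = 0 from hm']; exact lt_irrefl 0)
  rw [h.2.2.2 a, h.2.2.2 b, hdiff]

/-- The countable family of **rational closed balls**. [folklore] -/
def ratBall (i : ℚ × ℚ × ℚ) : Set ℂ :=
  Metric.closedBall (⟨(i.1 : ℝ), (i.2.1 : ℝ)⟩ : ℂ) (i.2.2 : ℝ)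

/-- Rational balls are closed. [folklore] -/
theorem isClosed_ratBall (i : ℚ × ℚ × ℚ) : IsClosed (ratBall i) := Metric.isClosed_closedBall

/-- A point off a closed set lies in a rational closed ball disjoint from the set. [folklore] -/
theorem exists_ratBall_disjoint {S : Set ℂ} (hS : IsClosed S) {p : ℂ} (hp : p ∉ S) :
    ∃ i : ℚ × ℚ × ℚ, p ∈ ratBall i ∧ Disjoint (ratBall i) S := by
  obtain ⟨ε, hε, hball⟩ := Metric.isOpen_iff.1 hS.isOpen_compl p hp
  obtain ⟨r, hr0, hrε⟩ := exists_rat_btwn (show (0 : ℝ) < ε / 3 by positivity)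
  have hr0' : (0 : ℝ) < r := by exact_mod_cast hr0
  obtain ⟨a, ha1, ha2⟩ := exists_rat_btwn (show p.re - r / 2 < p.re + r / 2 by linarith)
  obtain ⟨b, hb1, hb2⟩ := exists_rat_btwn (show p.im - r / 2 < p.im + r / 2 by linarith)
  refine ⟨⟨a, b, r⟩, ?_, ?_⟩
  · change dist p (⟨(a : ℝ), (b : ℝ)⟩ : ℂ) ≤ (r : ℝ)
    rw [Complex.dist_eq]
    refine (Complex.norm_le_abs_re_add_abs_im _).trans ?_
    simp only [Complex.sub_re, Complex.sub_im]
    have h1 : |p.re - a| ≤ r / 2 := abs_le.2 ⟨by linarith, by linarith⟩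
    have h2 : |p.im - b| ≤ r / 2 := abs_le.2 ⟨by linarith, by linarith⟩
    linarith
  · refine Set.disjoint_left.2 fun z hz hzS ↦ ?_
    have hzb : z ∈ Metric.ball p ε := by
      rw [Metric.mem_ball]
      have hzc : dist z (⟨(a : ℝ), (b : ℝ)⟩ : ℂ) ≤ r := hz
      have hpc : dist p (⟨(a : ℝ), (b : ℝ)⟩ : ℂ) ≤ r := by
        rw [Complex.dist_eq]
        refine (Complex.norm_le_abs_re_add_abs_im _).trans ?_
        simp only [Complex.sub_re, Complex.sub_im]
        have h1 : |p.re - a| ≤ r / 2 := abs_le.2 ⟨by linarith, by linarith⟩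
        have h2 : |p.im - b| ≤ r / 2 := abs_le.2 ⟨by linarith, by linarith⟩
        linarith
      calc dist z p ≤ dist z (⟨(a : ℝ), (b : ℝ)⟩ : ℂ) + dist p (⟨(a : ℝ), (b : ℝ)⟩ : ℂ) :=
            dist_triangle_right _ _ _
        _ ≤ r + r := add_le_add hzc hpc
        _ < ε := by linarith
    exact hball hzb hzS

/-! ### Touching after a first visit, from the after-chain -/

/-- **Touching from the after-chain.** If `γ(r + u) = f̄_r(γ'(u) + W r)` for a chain `(W', γ')`
started at `0` whose swallowing times `T'_{1/(k+1)}` tend to `0`, and `γ r` is visited first at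
`r`, then there are times `vₙ ↓ 0`, `vₙ > 0`, with `γ(r + vₙ) ∈ (γ[0, r] ∪ ℝ) ∖ {γ r}`. [folklore] -/
theorem IsGeneratedByCurve.exists_touch_of_after (hW : Continuous W) (hγ : IsGeneratedByCurve W γ)
    {r : ℝ≥0} (hfv : γ r ∉ γ '' Iio r) {W' : ℝ≥0 → ℝ} (hW' : Continuous W') (hW'0 : W' 0 = 0)
    {γ' : ℝ≥0 → ℂ} (hγ' : IsGeneratedByCurve W' γ')
    (hconj : ∀ u, γ (r + u) = bdryInv W r (γ' u + W r))
    (hT : Tendsto (fun k : ℕ ↦ swallowingTime W' ((((1 : ℝ) / ((k : ℝ) + 1) : ℝ)) : ℂ)) atTop (𝓝 0)) :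
    ∃ v : ℕ → ℝ≥0, Tendsto v atTop (𝓝 0) ∧ ∀ n, 0 < v n ∧
      γ (r + v n) ∈ γ '' Icc 0 r ∪ {z : ℂ | z.im = 0} ∧ γ (r + v n) ≠ γ r := by
  set x : ℕ → ℝ := fun k ↦ (1 : ℝ) / ((k : ℝ) + 1) with hx
  have hxpos : ∀ k, 0 < x k := fun k ↦ by rw [hx]; positivity
  -- eventually the swallowing times are finite (indeed `< 1`)
  have hev : ∀ᶠ k in atTop, swallowingTime W' ((x k : ℝ) : ℂ) < ((1 : ℝ≥0) : WithTop ℝ≥0) :=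
    (tendsto_order.1 hT).2 _ (by exact_mod_cast zero_lt_one)
  obtain ⟨k₀, hk₀⟩ := eventually_atTop.1 hev
  -- the finite swallowing times as `ℝ≥0`
  have hfin : ∀ n, swallowingTime W' ((x (n + k₀) : ℝ) : ℂ) ≠ ⊤ := fun n ↦
    (lt_of_lt_of_le (hk₀ _ (Nat.le_add_left _ _)) le_top).ne
  set v : ℕ → ℝ≥0 := fun n ↦ (swallowingTime W' ((x (n + k₀) : ℝ) : ℂ)).untopD 0 with hv
  have hcoe : ∀ n, ((v n : ℝ≥0) : WithTop ℝ≥0) = swallowingTime W' ((x (n + k₀) : ℝ) : ℂ) := by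
    intro n
    obtain ⟨t, ht⟩ := WithTop.ne_top_iff_exists.1 (hfin n)
    rw [hv]
    simp only [← ht, WithTop.untopD_coe]
  refine ⟨v, ?_, fun n ↦ ?_⟩
  · -- `v → 0`
    have hT' : Tendsto (fun n ↦ swallowingTime W' ((x (n + k₀) : ℝ) : ℂ)) atTop (𝓝 0) :=
      hT.comp (tendsto_add_atTop_nat k₀)
    rw [tendsto_order]
    refine ⟨fun a ha ↦ absurd ha (not_lt_of_ge (zero_le (a := a))), fun a ha ↦ ?_⟩
    have hev' := (tendsto_order.1 hT').2 (a : WithTop ℝ≥0) (by exact_mod_cast ha)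
    filter_upwards [hev'] with n hn
    rw [← hcoe n] at hn
    exact_mod_cast hn
  · set k := n + k₀ with hk
    have hfirst : swallowingTime W' ((x k : ℝ) : ℂ) = firstHit γ' (realRay (x k)) :=
      swallowingTime_ofReal_eq_firstHit_of_ne hW' hW'0 hγ' (hxpos k).ne'
    have hne : firstHit γ' (realRay (x k)) ≠ ⊤ := by rw [← hfirst]; exact hfin n
    obtain ⟨t₀, ht₀, hmem⟩ := exists_firstHit_eq_coe hγ'.1 (isClosed_realRay _) hne
    have htv : t₀ = v n := by
      have h1 : ((t₀ : ℝ≥0) : WithTop ℝ≥0) = v n := by rw [hcoe n, hfirst, ht₀]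
      exact_mod_cast h1
    rw [htv] at hmem
    obtain ⟨him, hre⟩ := (mem_realRay_iff_of_pos (hxpos k)).1 hmem
    -- the touching point is `f̄_r` of a real point
    have hreal : γ' (v n) + W r = (((γ' (v n)).re + W r : ℝ) : ℂ) := by
      apply Complex.ext <;> simp [him]
    have hpt : γ (r + v n) = bdryInv W r (((γ' (v n)).re + W r : ℝ) : ℂ) := by
      rw [hconj, hreal]
    refine ⟨?_, ?_, ?_⟩
    · -- `v n > 0`: `γ' 0 = 0 ∉ realRay (x k)`
      rcases (zero_le (a := v n)).lt_or_eq with h | h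
      · exact h
      · exfalso
        rw [← h, hγ'.2.1, hW'0] at hre
        simp at hre
        exact absurd hre (not_le.2 (hxpos k))
    · rw [hpt]
      exact hγ.bdryInv_ofReal_mem hW r _
    · intro heq
      rw [hpt] at heq
      have h := hγ.eq_driving_of_bdryInv_eq_of_notMem hW hfv heq
      have : (γ' (v n)).re = 0 := by linarith
      linarith [hxpos k]

/-! ### The pathwise conclusion -/

/-- **Arc confinement, pathwise.** If the curve of a generated chain touches `ℝ ∪ past` right
after the first hitting time of every rational ball first hit at an interior, first-visit point,
then no continuous real function is injective on any piece `γ[t₁, t₂]`, `t₁ < t₂`. [folklore] -/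
theorem IsGeneratedByCurve.not_injOn_of_touch (hW : Continuous W) (hγ : IsGeneratedByCurve W γ)
    (HT : ∀ (i : ℚ × ℚ × ℚ) (r : ℝ≥0), firstHit γ (ratBall i) = r → 0 < (γ r).im →
      γ r ∉ γ '' Iio r → ∃ v : ℕ → ℝ≥0, Tendsto v atTop (𝓝 0) ∧ ∀ n, 0 < v n ∧
        γ (r + v n) ∈ γ '' Icc 0 r ∪ {z : ℂ | z.im = 0} ∧ γ (r + v n) ≠ γ r)
    {t₁ t₂ : ℝ≥0} (hlt : t₁ < t₂) {ρ : ℂ → ℝ} (hρ : Continuous ρ) :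
    ¬ InjOn ρ (γ '' Icc t₁ t₂) := by
  intro hinj
  -- a point of `γ(t₁, t₂)` off `γ[0, t₁] ∪ ℝ`
  obtain ⟨s, hs₁, hs₂⟩ := exists_between hlt
  set S : Set ℂ := γ '' Icc 0 t₁ ∪ {z : ℂ | z.im = 0} with hSdef
  have hSc : IsClosed S :=
    ((isCompact_Icc.image hγ.1).isClosed).union (isClosed_eq Complex.continuous_im continuous_const)
  obtain ⟨t', ht', hnot⟩ : ∃ t' ∈ Icc t₁ s, γ t' ∉ S := by
    by_contra hcon
    push Not at hcon
    exact hγ.not_image_Icc_subset_union_real hW hs₁ (by rintro _ ⟨t, ht, rfl⟩; exact hcon t ht)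
  have ht'₁ : t₁ < t' := ht'.1.lt_of_ne (by
    rintro rfl
    exact hnot (Or.inl ⟨t₁, ⟨zero_le, le_rfl⟩, rfl⟩))
  -- a rational ball around it, off `S`
  obtain ⟨i, hpi, hdisj⟩ := exists_ratBall_disjoint hSc hnot
  -- its first hitting time `r`
  have hle : firstHit γ (ratBall i) ≤ t' := firstHit_le hpi
  have hne : firstHit γ (ratBall i) ≠ ⊤ := (lt_of_le_of_lt hle (WithTop.coe_lt_top _)).ne
  obtain ⟨r, hr, hγr⟩ := exists_firstHit_eq_coe hγ.1 (isClosed_ratBall i) hne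
  have hrt' : r ≤ t' := by rw [hr] at hle; exact_mod_cast hle
  have hrt₂ : r < t₂ := hrt'.trans_lt (ht'.2.trans_lt hs₂)
  have hbefore : ∀ u, u < r → γ u ∉ ratBall i := fun u hu ↦
    notMem_of_lt_firstHit (by rw [hr]; exact_mod_cast hu)
  have hγrS : γ r ∉ S := Set.disjoint_left.1 hdisj hγr
  have ht₁r : t₁ < r := by
    by_contra hcon
    push Not at hcon
    exact hγrS (Or.inl ⟨r, ⟨zero_le, hcon⟩, rfl⟩)
  have him : 0 < (γ r).im :=
    (hγ.2.2.1 r).lt_of_ne (fun h ↦ hγrS (Or.inr h.symm))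
  have hfv : γ r ∉ γ '' Iio r := by
    rintro ⟨u, hu, hur⟩
    exact hbefore u hu (hur ▸ hγr)
  -- the touching times
  obtain ⟨v, hv0, hv⟩ := HT i r hr him hfv
  -- eventually the touching points are interior points and the times stay below `t₂`
  have hlim : Tendsto (fun n ↦ γ (r + v n)) atTop (𝓝 (γ r)) := by
    have h1 : Tendsto (fun n ↦ r + v n) atTop (𝓝 (r + 0)) := tendsto_const_nhds.add hv0
    rw [add_zero] at h1
    exact (hγ.1.tendsto r).comp h1
  have hev1 : ∀ᶠ n in atTop, 0 < (γ (r + v n)).im :=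
    hlim (isOpen_lt continuous_const Complex.continuous_im |>.mem_nhds him)
  have hpos : 0 < t₂ - r := tsub_pos_of_lt hrt₂
  have hev2 : ∀ᶠ n in atTop, v n < t₂ - r := (tendsto_order.1 hv0).2 _ hpos
  obtain ⟨n₀, hn₀⟩ := eventually_atTop.1 (hev1.and hev2)
  set u : ℕ → ℝ≥0 := fun n ↦ r + v (n + n₀) with hu
  have huT : Tendsto u atTop (𝓝 r) := by
    have h1 : Tendsto (fun n ↦ r + v (n + n₀)) atTop (𝓝 (r + 0)) :=
      tendsto_const_nhds.add (hv0.comp (tendsto_add_atTop_nat n₀))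
    rwa [add_zero] at h1
  have huI : ∀ n, u n ∈ Ioc r t₂ := fun n ↦ by
    obtain ⟨-, h2⟩ := hn₀ (n + n₀) (Nat.le_add_left _ _)
    exact ⟨lt_add_of_pos_right _ (hv (n + n₀)).1, (lt_tsub_iff_left.1 h2).le⟩
  have hpast : ∀ n, γ (u n) ∈ γ '' Icc 0 r := fun n ↦ by
    obtain ⟨h1, -⟩ := hn₀ (n + n₀) (Nat.le_add_left _ _)
    rcases (hv (n + n₀)).2.1 with h | h
    · exact h
    · exact absurd h (ne_of_gt h1)
  have hneq : ∀ n, γ (u n) ≠ γ r := fun n ↦ (hv (n + n₀)).2.2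
  -- the deterministic core
  obtain ⟨s₀, hs₀, hs₀r⟩ := hγ.mem_image_Icc_of_injOn hW ht₁r hrt₂ hρ hinj huT huI hpast hneq
  exact hbefore s₀ (hs₀.2.trans_lt ht₁r) (hs₀r ▸ hγr)

end Loewner

/-! ### The almost sure statement for the SLE_κ trace, `4 < κ < 8` -/

section SLE

variable {κ : ℝ≥0}

/-- `sleDrivingAfter κ τ ω 0 = 0`. [folklore] -/
theorem sleDrivingAfter_apply_zero (κ : ℝ≥0) (τ : (ℝ≥0 → ℝ) → WithTop ℝ≥0) (ω : ℝ≥0 → ℝ) :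
    sleDrivingAfter κ τ ω 0 = 0 := by
  simp [sleDrivingAfter]

/-- **Per ball**: almost surely, at the hitting time of the closed set `A` (if finite, at a
first-visit interior point), the curve touches `ℝ ∪ past` at points `≠` the tip at times `↓ 0`.
[cite: RohdeSchramm2005, §7] -/
theorem ae_touch_at_hitting (hκ4 : 4 < κ) (hκ8 : κ < 8) {A : Set ℂ} (hA : IsClosed A) :
    ∀ᵐ ω ∂Process.preWienerMeasure, ∀ r : ℝ≥0, firstHit (sleTrace κ ω) A = r →
      0 < (sleTrace κ ω r).im → sleTrace κ ω r ∉ sleTrace κ ω '' Iio r →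
      ∃ v : ℕ → ℝ≥0, Tendsto v atTop (𝓝 0) ∧ ∀ n, 0 < v n ∧
        sleTrace κ ω (r + v n) ∈ sleTrace κ ω '' Icc 0 r ∪ {z : ℂ | z.im = 0} ∧
        sleTrace κ ω (r + v n) ≠ sleTrace κ ω r := by
  have h8 : κ ≠ 8 := hκ8.ne
  have h0 : HasSLETrace κ := hasSLETrace_of_ne_eight_apply h8
  have hκ0 : 0 < κ := lt_trans (by norm_num) hκ4
  set τ : (ℝ≥0 → ℝ) → WithTop ℝ≥0 := hittingAfter (fun t ω ↦ sleTrace κ ω t) A 0 with hτdef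
  have hii := ae_sleTrace_add_eq_extendFrom_hitting h0 hκ0 hA
  dsimp only at hii
  obtain ⟨σ, hσ, hσeq⟩ := exists_isStoppingTime_rightCont_ae_eq_hitting h0 hA
  have hB := ae_tendsto_swallowingTime_sleDrivingAfter_zero hκ4 hσ
  filter_upwards [h0, hii, hσeq, hB] with ω hgen' hconj hστ hT r hr him hfv
  have hgen : Loewner.IsGeneratedByCurve (sleDriving κ ω) (sleTrace κ ω) :=
    Loewner.isGeneratedByCurve_trace hgen'
  have hτr : τ ω = r := by
    rw [hτdef, ← firstHit_eq_hittingAfter (fun t ω ↦ sleTrace κ ω t) A ω]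
    exact hr
  obtain ⟨hgenA, hshift⟩ := hconj r hτr
  have hστ' : σ ω = τ ω := hστ
  have hT' : Tendsto (fun k : ℕ ↦ Loewner.swallowingTime (sleDrivingAfter κ τ ω)
      ((((1 : ℝ) / ((k : ℝ) + 1) : ℝ)) : ℂ)) atTop (𝓝 0) := by
    rw [← sleDrivingAfter_congr hστ']
    exact hT (by rw [hστ', hτr]; exact WithTop.coe_ne_top)
  exact hgen.exists_touch_of_after (continuous_sleDriving κ ω) hfv (continuous_sleDrivingAfter ω)
    (sleDrivingAfter_apply_zero κ τ ω) hgenA (fun u ↦ hshift u) hT'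

/-- **Arc confinement of the SLE_κ trace, `4 < κ < 8`.** Almost surely, for all `t₁ < t₂` no
continuous real function is injective on `γ[t₁, t₂]`: no piece of the trace is confined to a
simple arc (in particular to a line or a circle). [cite: RohdeSchramm2005, §7] -/
theorem ae_not_injOn_sleTrace (hκ4 : 4 < κ) (hκ8 : κ < 8) :
    ∀ᵐ ω ∂Process.preWienerMeasure, ∀ t₁ t₂ : ℝ≥0, t₁ < t₂ → ∀ ρ : ℂ → ℝ, Continuous ρ →
      ¬ InjOn ρ (sleTrace κ ω '' Icc t₁ t₂) := by
  have h8 : κ ≠ 8 := hκ8.ne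
  have h0 : HasSLETrace κ := hasSLETrace_of_ne_eight_apply h8
  have hall : ∀ᵐ ω ∂Process.preWienerMeasure, ∀ i : ℚ × ℚ × ℚ, ∀ r : ℝ≥0,
      firstHit (sleTrace κ ω) (Loewner.ratBall i) = r →
      0 < (sleTrace κ ω r).im → sleTrace κ ω r ∉ sleTrace κ ω '' Iio r →
      ∃ v : ℕ → ℝ≥0, Tendsto v atTop (𝓝 0) ∧ ∀ n, 0 < v n ∧
        sleTrace κ ω (r + v n) ∈ sleTrace κ ω '' Icc 0 r ∪ {z : ℂ | z.im = 0} ∧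
        sleTrace κ ω (r + v n) ≠ sleTrace κ ω r :=
    ae_all_iff.2 fun i ↦ ae_touch_at_hitting hκ4 hκ8 (Loewner.isClosed_ratBall i)
  filter_upwards [h0, hall] with ω hgen' HT t₁ t₂ hlt ρ hρ
  exact (Loewner.isGeneratedByCurve_trace hgen').not_injOn_of_touch (continuous_sleDriving κ ω) HT hlt hρ

end SLE

end Literature.Probability.RandomPlanarGeometry

end
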